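import Literature.AlgebraicGeometry.AbelianSchemes.AbelianSchemeLDeltaLocusOfPolarization
import Literature.AlgebraicGeometry.AbelianSchemes.AbelianSchemeMumfordBundleClassifierAnyBase
import Literature.AlgebraicGeometry.AbelianVarieties.LineBundleTensorPower
import HarnessLib

/-!
# The classification letter of `[2k] ≫ λ` for a polarisation `λ`: «`[2k]λ` classifies `Λ(L′)` whenever `L′ ≅ L^Δ(λ)^{⊗k}`»
# — over the base itself, ANY locally Noetherian `S` ([MumfordFogartyKirwan1994] Prop. 6.10 / 6.11, Prop. 7.3 step (V))

Layer `Literature/AlgebraicGeometry/AbelianSchemes`, namespace `Literature.AlgebraicGeometry.AbelianSchemes.AbelianSchemeOver`.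
THEOREMS ONLY (no definition, no named fact, no instance, no notation, no `sorry`).  Cell `hodgecm-mathlib` (D-0151), F-DAG row F-6
(H-rep), brick R-B1 of the R-B file `MFKIntrinsicOfLinearRigidification` (B-plan1 (g17) 2026-08-30T10:56:54Z; B-p18 (g19) split
10:55:54Z «class letter = ★ `eq_mul_self_of_classify_mumfordBundle_LDelta` + Λ of tensor powers + ★ classifier existence»); author
B-p17 (g14).  HC_CM is proved only modulo the 7 printed citations until rung 0 closes; nothing here is about HC.

WHY A NEW FILE.  The ★ E-road heads (★ `pow_id_comp_eq_pullback_map_of_polarization`, ★ `exists_LDelta_of_polarization_tensorPow`,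
★ `nonempty_pullback_graph_pow_iso_tensorPow`) are all written for a BASE CHANGE `A_T = A ×_S T` of an abelian scheme `A/S` carrying the
line bundle upstairs (the LDelta-LOCUS setting of Prop. 6.11), with the classifying homomorphism `Λ(L)` GIVEN on `A`.  The (H-rep)
representability argument meets the opposite situation: an abelian scheme `A/S` with a polarisation `λ` and a rank-one `L′ ≅ L^Δ(λ)^{⊗k}`
ON `A` ITSELF, and must PRODUCE the letter «`[2k] ≫ λ` classifies `Λ(L′)`» that ★ FILE 3 `mfkIntrinsic_of_existsUnique_comp`'s intrinsic
clause INT(b) records (whisker spelling, `k = 3`, `2k = 6`).  This file proves it over the base itself, for ANY locally Noetherian `S`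
and the unit hypothesis `hD : 𝒫|_{A × {ε_Â}} ≅ 𝒪` (FINDING 8aea22b3 (R1)):
* §1 **`nonempty_pullback_graph_pow_iso_tensorPow_self`** — `Γ_{g^k}^*𝒫 ≅ (Γ_g^*𝒫)^{⊗k}` for an `S`-morphism `g : A → Â` and the
  graphs `Γ_{g^j} = (1, g^j) : A → A ×_S Â` (the graph is `Δ ≫ (A ◁ g^j)`; ★ `DualPair.nonempty_pullback_whiskerLeft_pow_iso_tensorPow`
  restricted along the diagonal, ★ `Modules.nonempty_pullback_tensorPow_iso`);
* §2 **`forall_nonempty_classify_pow_id_comp_of_nonempty_iso_tensorPow`** — for a polarisation `pol` (★ `Polarization`), its graph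
  `Γ₁`, and a rank-one `L′ ≅ (Γ₁^*𝒫)^{⊗k}`: **`(A ◁ (a ≫ [2k] ≫ λ))^*𝒫 ≅ (A ◁ a)^*Λ(L′)` for every `S`-scheme `U` and every point
  `a : U → A`**.  Proof = print's (Prop. 6.10 + rigidity), in the any-base form of ★ `pow_id_comp_eq_pullback_map_of_forall_isLambdaOfAt`
  but over `S` directly: `M := Γ_{λ^k}^*𝒫 ≅ L′` (§1) is rigidified along `ε` (`ε ≫ Γ_{λ^k} = ε_Â ≫ (ε × 1)`, `IsMonHom.one_hom`, clause (b)
  of the dual pair); ★ `exists_isMonHom_classify_mumfordBundle_of_isLocallyNoetherian_base` gives a homomorphism `λ_M` classifying `Λ(M)`;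
  on every geometric fibre `λ_M = λ^k·λ^k` (★ `pullback_map_eq_pullback_map_mul_self` = Prop. 6.10 with the witness `k•Θ_t`, ★
  `IsLambdaOfAt.pow_nsmul`, ★ `Polarization.exists_ample`), hence globally (★ `hom_eq_of_forall_pullback_map_eq_of_isLocallyNoetherian_base`,
  Cor. 6.2/6.4 — no connectedness, no reducedness), and `λ^k·λ^k = λ^{2k} = [2k] ≫ λ` (Mathlib `MonObj.pow_comp`); finally `Λ(M) ≅ Λ(L′)` (★
  `nonempty_mumfordBundle_iso_of_nonempty_iso`).  §2 also records the cube spelling `…_pow_six_…` (`k = 3`, the letter of INT(b)).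

## References
* [MumfordFogartyKirwan1994] D. Mumford, J. Fogarty, F. Kirwan, *Geometric Invariant Theory*, 3rd ed. (1994), Ch. 6 §2
  Proposition 6.10 (p. 121), Proposition 6.11 (p. 122; proof pp. 122–123), Definition 6.2 (p. 120); Ch. 6 §1 Corollary 6.2 (p. 116) and
  Corollary 6.4 (p. 117); Ch. 7 §2 Proposition 7.3 (pp. 132–134), step (V).
* [MumfordAV1970] D. Mumford, *Abelian Varieties* (1970), §8 (pp. 74–75), §13 (pp. 123–125).
* [MilneAV2008] J. S. Milne, *Abelian Varieties* (v2.00, 2008), I §8 pp. 36–37.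
-/

-- `Scheme.Modules` / `SheafOfModules` are not reducible; `(A.X ⊗ B.X).left = A.prodLeft B` holds by `rfl` only
-- (as in ★ `AbelianSchemeKOfL`, ★ `AbelianSchemeLDeltaLocusOfPolarization`).
set_option backward.isDefEq.respectTransparency false

noncomputable section

open CategoryTheory CategoryTheory.Limits AlgebraicGeometry MonoidalCategory CartesianMonoidalCategory
open scoped MonObj

universe u

namespace Literature.AlgebraicGeometry.AbelianSchemes

open Literature.AlgebraicGeometry.Motives Literature.AlgebraicGeometry.Modules
  Literature.AlgebraicGeometry.AbelianVarieties

namespace AbelianSchemeOver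

/-! ## §0 Two generalities (private copies, as in ★ `AbelianSchemeLDeltaLocusOfPolarization` / ★ `…LDeltaLocusTensorPow`) -/

/-- `f ^ n` is a homomorphism for a homomorphism `f` into a commutative group object. [cite: MumfordFogartyKirwan1994, Ch. 6 §1 Corollary 6.5 (p. 117)] -/
private theorem isMonHom_pow_aux {C : Type*} [Category C] [CartesianMonoidalCategory C] [BraidedCategory C] {X M : C}
    [MonObj X] [MonObj M] [IsCommMonObj M] (f : X ⟶ M) [IsMonHom f] (n : ℕ) : IsMonHom (f ^ n) := by
  induction n with
  | zero => rw [pow_zero, Hom.one_def]; infer_instance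
  | succ n ih => rw [pow_succ, Hom.mul_def]; infer_instance

/-- Tensor powers of isomorphic modules are isomorphic. [folklore] -/
private theorem nonempty_tensorPow_iso_of_iso_aux {X : Scheme.{u}} {M M' : X.Modules} (e : M ≅ M') :
    ∀ n : ℕ, Nonempty (tensorPow M n ≅ tensorPow M' n)
  | 0 => ⟨Iso.refl _⟩
  | n + 1 => (nonempty_tensorPow_iso_of_iso_aux e n).map fun i => tensorMapIso i e

variable {S : Scheme.{u}} [IsLocallyNoetherian S] (A : AbelianSchemeOver S) (D : A.DualPair)
  (hD : Nonempty ((Scheme.Modules.pullback (DualPair.unitHatSlice D)).obj D.P ≅ SheafOfModules.unit _))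

/-! ## §1 `Γ_{g^k}^*𝒫 ≅ (Γ_g^*𝒫)^{⊗k}` for graphs over the base itself -/

omit [IsLocallyNoetherian S] in
/-- **The graph of `g^j` is the diagonal followed by `1_A × g^j`**: for an `S`-morphism `g : A → Â` and `Γ : A → A ×_S Â` with
projections `(𝟙, (g^j))`, `Γ = Δ_A ≫ (A ◁ g^j)` (`pullback.hom_ext`; Mathlib `Over.whiskerLeft_left_fst/_snd`).
[cite: MumfordFogartyKirwan1994, Ch. 6 §2 Proposition 6.10 (p. 121)] -/
theorem graph_eq_diag_comp_whiskerLeft_left (g : A.X ⟶ D.hat.X) (j : ℕ) (Γ : A.left ⟶ A.prodLeft D.hat)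
    (hΓ₁ : Γ ≫ pullback.fst A.X.hom D.hat.X.hom = 𝟙 _) (hΓ₂ : Γ ≫ pullback.snd A.X.hom D.hat.X.hom = (g ^ j).left) :
    Γ = (pullback.lift (𝟙 A.left) (𝟙 A.left) rfl : A.left ⟶ pullback A.X.hom A.X.hom) ≫ (A.X ◁ (g ^ j)).left := by
  apply pullback.hom_ext
  · rw [hΓ₁, Category.assoc, Over.whiskerLeft_left_fst (R := A.X) (g ^ j), pullback.lift_fst]
  · rw [hΓ₂, Category.assoc, Over.whiskerLeft_left_snd (R := A.X) (g ^ j), pullback.lift_snd_assoc, Category.id_comp]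

include hD in
/-- **`Γ_{g^k}^*𝒫 ≅ (Γ_g^*𝒫)^{⊗k}` over the base itself** («`L^Δ(g^k) ≅ L^Δ(g)^{⊗k}`», ANY locally Noetherian `S` with the unit
hypothesis `hD`): for an `S`-morphism `g : A → Â` and `Γ₁ = (1, g)`, `Γ_k = (1, g^k) : A → A ×_S Â`.  Proof: `Γ_j = Δ ≫ (A ◁ g^j)`
(`graph_eq_diag_comp_whiskerLeft_left`), ★ `DualPair.nonempty_pullback_whiskerLeft_pow_iso_tensorPow` («`(A ◁ g^k)^*𝒫 ≅ ((A ◁ g)^*𝒫)^{⊗k}`»,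
the group law of `Â` is the tensor product of families) restricted along `Δ` (★ `Modules.nonempty_pullback_tensorPow_iso`).
[cite: MumfordFogartyKirwan1994, Ch. 6 §2 Proposition 6.10 (p. 121) and Proposition 6.11 (p. 122; proof pp. 122–123)]
[cite: MumfordAV1970, §8 (pp. 74–75) and §13 (p. 123)] -/
theorem nonempty_pullback_graph_pow_iso_tensorPow_self (g : A.X ⟶ D.hat.X) (k : ℕ) (Γ₁ Γk : A.left ⟶ A.prodLeft D.hat)
    (hΓ₁₁ : Γ₁ ≫ pullback.fst A.X.hom D.hat.X.hom = 𝟙 _) (hΓ₁₂ : Γ₁ ≫ pullback.snd A.X.hom D.hat.X.hom = g.left)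
    (hΓk₁ : Γk ≫ pullback.fst A.X.hom D.hat.X.hom = 𝟙 _) (hΓk₂ : Γk ≫ pullback.snd A.X.hom D.hat.X.hom = (g ^ k).left) :
    Nonempty ((Scheme.Modules.pullback Γk).obj D.P ≅ tensorPow ((Scheme.Modules.pullback Γ₁).obj D.P) k) := by
  -- the diagonal `Δ : A → A ×_S A`
  let σ : A.left ⟶ pullback A.X.hom A.X.hom := pullback.lift (𝟙 A.left) (𝟙 A.left) rfl
  have eΓ : ∀ (n : ℕ) (Γ : A.left ⟶ A.prodLeft D.hat),
      Γ ≫ pullback.fst A.X.hom D.hat.X.hom = 𝟙 _ → Γ ≫ pullback.snd A.X.hom D.hat.X.hom = (g ^ n).left →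
        Nonempty ((Scheme.Modules.pullback Γ).obj D.P ≅
          (Scheme.Modules.pullback σ).obj ((Scheme.Modules.pullback (A.X ◁ (g ^ n)).left).obj D.P)) := fun n Γ h₁ h₂ =>
    ⟨(Scheme.Modules.pullbackCongr (A.graph_eq_diag_comp_whiskerLeft_left D g n Γ h₁ h₂)).app D.P ≪≫
      ((Scheme.Modules.pullbackComp σ (A.X ◁ (g ^ n)).left).app D.P).symm⟩
  -- §2 of ★ `PoincareSheafBiadditiveAnyBase` along `g`, restricted along `Δ`
  obtain ⟨p⟩ := D.nonempty_pullback_whiskerLeft_pow_iso_tensorPow hD g k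
  have h₁ : HasRank ((Scheme.Modules.pullback (A.X ◁ g).left).obj D.P) 1 := hasRank_pullback _ D.hasRank_one
  obtain ⟨t⟩ := Modules.nonempty_pullback_tensorPow_iso σ h₁ k
  obtain ⟨ek⟩ := eΓ k Γk hΓk₁ hΓk₂
  obtain ⟨e₁⟩ := eΓ 1 Γ₁ hΓ₁₁ (by rw [pow_one]; exact hΓ₁₂)
  have e₁' : (Scheme.Modules.pullback σ).obj ((Scheme.Modules.pullback (A.X ◁ g).left).obj D.P) ≅
      (Scheme.Modules.pullback Γ₁).obj D.P :=
    (Scheme.Modules.pullback σ).mapIso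
        ((Scheme.Modules.pullbackCongr (congrArg (fun x : A.X ⟶ D.hat.X => (A.X ◁ x).left) (pow_one g).symm)).app D.P) ≪≫
      e₁.symm
  obtain ⟨tk⟩ := nonempty_tensorPow_iso_of_iso_aux e₁' k
  exact ⟨ek ≪≫ (Scheme.Modules.pullback σ).mapIso p ≪≫ t ≪≫ tk⟩

/-! ## §2 «`[2k] ≫ λ` classifies `Λ(L′)` for `L′ ≅ L^Δ(λ)^{⊗k}`» — the (P)-clause of INT(b) from a polarisation -/

include hD in
/-- **The classification letter from a polarisation, over ANY locally Noetherian base** ([MumfordFogartyKirwan1994] Prop. 6.10 «`Λ(L^Δ(λ)) =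
2λ`» with Prop. 6.11 / Prop. 7.3 step (V)): let `S` be locally Noetherian, `D = (Â, 𝒫)` a dual pair of `A/S` with `𝒫|_{A × {ε_Â}} ≅ 𝒪`,
`pol` a polarisation (★ `Polarization`: a homomorphism which is `Λ(𝒪(Θ_t))`, `Θ_t` ample, at every geometric point), `Γ₁ = (1, λ) :
A → A ×_S Â` its graph and `L′` a rank-one module on `A` with `L′ ≅ (Γ₁^*𝒫)^{⊗k} = L^Δ(λ)^{⊗k}`.  Then for every `S`-scheme `U` and every
`a : U → A`, **`(A ◁ (a ≫ [2k] ≫ λ))^*𝒫 ≅ (A ◁ a)^*Λ(L′)`** — `[2k] ≫ λ` CLASSIFIES the Mumford family of `L′` (whisker spelling of ★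
`exists_isMonHom_classify_mumfordBundle_of_isLocallyNoetherian_base`).  Proof: `M := Γ_{λ^k}^*𝒫 ≅ L′` (§1) is rigidified along `ε`
(`ε ≫ Γ_{λ^k} = ε_Â ≫ (ε × 1)` by `IsMonHom.one_hom`; clause (b) of the dual pair); its classifying homomorphism `λ_M` (★ any-base
classifier) equals `λ^k·λ^k` on every geometric fibre (★ `pullback_map_eq_pullback_map_mul_self`, witness `k•Θ_t` by ★ `IsLambdaOfAt.pow_nsmul`),
hence globally (★ `hom_eq_of_forall_pullback_map_eq_of_isLocallyNoetherian_base`), and `λ^k·λ^k = [2k] ≫ λ` (Mathlib `MonObj.pow_comp`);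
`Λ(M) ≅ Λ(L′)` (★ `nonempty_mumfordBundle_iso_of_nonempty_iso`).
[cite: MumfordFogartyKirwan1994, Ch. 6 §2 Proposition 6.10 (p. 121) and Prop. 6.11 (p. 122; proof pp. 122–123)]
[cite: MumfordFogartyKirwan1994, Ch. 6 §1 Corollary 6.2 (p. 116) and Corollary 6.4 (p. 117)]
[cite: MumfordFogartyKirwan1994, Ch. 7 §2 Proposition 7.3 (pp. 132–134)] -/
theorem forall_nonempty_classify_pow_id_comp_of_nonempty_iso_tensorPow (pol : A.Polarization D) (k : ℕ)
    (Γ₁ : A.left ⟶ A.prodLeft D.hat) (hΓ₁₁ : Γ₁ ≫ pullback.fst A.X.hom D.hat.X.hom = 𝟙 _)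
    (hΓ₁₂ : Γ₁ ≫ pullback.snd A.X.hom D.hat.X.hom = pol.lam.left)
    {L' : A.left.Modules} (hL' : HasRank L' 1)
    (e : Nonempty (L' ≅ tensorPow ((Scheme.Modules.pullback Γ₁).obj D.P) k))
    ⦃U : Over S⦄ (a : U ⟶ A.X) :
    Nonempty ((Scheme.Modules.pullback (A.X ◁ (a ≫ ((𝟙 A.X) ^ (2 * k)) ≫ pol.lam)).left).obj D.P ≅
      (Scheme.Modules.pullback (A.X ◁ a).left).obj (A.mumfordBundle L')) := by
  haveI := pol.isMonHom
  haveI : IsCommMonObj D.hat.X := D.hat.isCommMonObj_of_isLocallyNoetherian_base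
  haveI : IsMonHom (pol.lam ^ k) := isMonHom_pow_aux pol.lam k
  haveI : IsMonHom (pol.lam ^ k * pol.lam ^ k) := by rw [Hom.mul_def]; infer_instance
  -- the graph `Γ_k = (1, λ^k) : A → A ×_S Â` of `λ^k`
  let Γk : A.left ⟶ A.prodLeft D.hat :=
    pullback.lift (𝟙 _) (pol.lam ^ k).left (by rw [Category.id_comp]; exact (Over.w (pol.lam ^ k)).symm)
  have hΓk₁ : Γk ≫ pullback.fst A.X.hom D.hat.X.hom = 𝟙 _ := pullback.lift_fst _ _ _
  have hΓk₂ : Γk ≫ pullback.snd A.X.hom D.hat.X.hom = (pol.lam ^ k).left := pullback.lift_snd _ _ _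
  -- `M := Γ_k^*𝒫 ≅ (Γ₁^*𝒫)^{⊗k} ≅ L′`
  obtain ⟨c⟩ := A.nonempty_pullback_graph_pow_iso_tensorPow_self D hD pol.lam k Γ₁ Γk hΓ₁₁ hΓ₁₂ hΓk₁ hΓk₂
  have iM : (Scheme.Modules.pullback Γk).obj D.P ≅ L' := c ≪≫ (Classical.choice e).symm
  have hM : HasRank ((Scheme.Modules.pullback Γk).obj D.P) 1 := hasRank_pullback Γk D.hasRank_one
  -- `ε ≫ Γ_k = ε_Â ≫ (ε × 1_Â)`: `λ^k` is a homomorphism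
  have hεΓ : A.unitSection ≫ Γk = D.hat.unitSection ≫ A.unitSlice D.hat := by
    apply pullback.hom_ext
    · rw [Category.assoc, hΓk₁, Category.comp_id, Category.assoc, unitSlice_fst, ← Category.assoc,
        D.hat.unitSection_comp_hom, Category.id_comp]
    · rw [Category.assoc, hΓk₂, Category.assoc, unitSlice_snd, Category.comp_id]
      change (η[A.X]).left ≫ (pol.lam ^ k).left = (η[D.hat.X]).left
      rw [← Over.comp_left, IsMonHom.one_hom]
  -- `M` is rigidified along `ε` (clause (b) of the dual pair: `(ε × 1)^*𝒫 ≅ 𝒪`)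
  have hε : CechPic.pullback A.unitSection
      (detClass (HasRank.isFiniteLocallyFree' (hasRank_pullback Γk D.hasRank_one))) = 1 := by
    obtain ⟨r⟩ := D.rigid
    rw [(detClass_eq_of_iso (Iso.refl _) (HasRank.isFiniteLocallyFree' hM)
        ((HasRank.isFiniteLocallyFree' D.hasRank_one).pullback Γk)).trans
        (detClass_pullback Γk (HasRank.isFiniteLocallyFree' D.hasRank_one)),
      ← CechPic.pullback_comp, hεΓ, CechPic.pullback_comp,
      ← detClass_pullback (A.unitSlice D.hat) (HasRank.isFiniteLocallyFree' D.hasRank_one),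
      detClass_eq_of_iso r ((HasRank.isFiniteLocallyFree' D.hasRank_one).pullback _)
        (HasRank.isFiniteLocallyFree' hasRank_unitModule),
      detClass_unitModule_eq_one, map_one]
  -- the classifying homomorphism `λ_M` of `Λ(M)` (★ any-base classifier)
  obtain ⟨lamL, hmon, hlamL, -⟩ := A.exists_isMonHom_classify_mumfordBundle_of_isLocallyNoetherian_base D hM hε hD
  haveI := hmon
  have hlamL' : ∀ ⦃T : Over S⦄ (u : T ⟶ A.X),
      Nonempty (D.pullbackP T.hom (u ≫ lamL).left (Over.w _) ≅
        (Scheme.Modules.pullback (A.X ◁ u).left).obj (A.mumfordBundle ((Scheme.Modules.pullback Γk).obj D.P))) := by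
    intro T u
    rw [DualPair.pullbackP_eq_pullback_whiskerLeft]
    exact hlamL u
  -- Prop. 6.10 on every geometric fibre for `λ^k` (witness `k•Θ_t`), then rigidity over the locally Noetherian base
  have hlam₂ : lamL = pol.lam ^ k * pol.lam ^ k :=
    hom_eq_of_forall_pullback_map_eq_of_isLocallyNoetherian_base (A := A) (B := D.hat) lamL (pol.lam ^ k * pol.lam ^ k)
      fun Ω _ _ t => by
        obtain ⟨Θ, -, hΘ⟩ := pol.exists_ample Ω t
        exact A.pullback_map_eq_pullback_map_mul_self D t (pol.lam ^ k) Γk hΓk₁ hΓk₂ hε lamL hlamL'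
          ⟨k • Θ, IsLambdaOfAt.pow_nsmul A D pol.lam t k hΘ⟩
  have h2k : ((𝟙 A.X) ^ (2 * k)) ≫ pol.lam = lamL := by
    rw [hlam₂, ← pow_add, ← two_mul, MonObj.pow_comp, Category.id_comp]
  -- the letter, moved along `M ≅ L′`
  rw [h2k]
  obtain ⟨i⟩ := hlamL a
  obtain ⟨j⟩ := A.nonempty_mumfordBundle_iso_of_nonempty_iso hM hL' ⟨iM⟩
  exact ⟨i ≪≫ (Scheme.Modules.pullback (A.X ◁ a).left).mapIso j⟩

include hD in
/-- **Cube spelling — the (P)-clause of ★ FILE 3 `mfkIntrinsic_of_existsUnique_comp`'s INT(b)** ([MumfordFogartyKirwan1994] Prop. 7.3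
step (V) «`L′ ≅ L^Δ(ω̄)^3`», so `[6]ω̄` classifies `Λ(L′)`): for a polarisation `pol` with graph `Γ₁` and a rank-one `L′ ≅ (Γ₁^*𝒫)^{⊗3}`,
`(A ◁ (a ≫ [6] ≫ λ))^*𝒫 ≅ (A ◁ a)^*Λ(L′)` for every point `a : U → A` (§2 at `k = 3`).
[cite: MumfordFogartyKirwan1994, Ch. 7 §2 Proposition 7.3 (pp. 132–134)] [cite: MumfordFogartyKirwan1994, Ch. 6 §2 Proposition 6.10 (p. 121)] -/
theorem forall_nonempty_classify_pow_six_comp_of_nonempty_iso_tensorPow_three (pol : A.Polarization D)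
    (Γ₁ : A.left ⟶ A.prodLeft D.hat) (hΓ₁₁ : Γ₁ ≫ pullback.fst A.X.hom D.hat.X.hom = 𝟙 _)
    (hΓ₁₂ : Γ₁ ≫ pullback.snd A.X.hom D.hat.X.hom = pol.lam.left)
    {L' : A.left.Modules} (hL' : HasRank L' 1)
    (e : Nonempty (L' ≅ tensorPow ((Scheme.Modules.pullback Γ₁).obj D.P) 3))
    ⦃U : Over S⦄ (a : U ⟶ A.X) :
    Nonempty ((Scheme.Modules.pullback (A.X ◁ (a ≫ ((𝟙 A.X) ^ 6) ≫ pol.lam)).left).obj D.P ≅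
      (Scheme.Modules.pullback (A.X ◁ a).left).obj (A.mumfordBundle L')) :=
  A.forall_nonempty_classify_pow_id_comp_of_nonempty_iso_tensorPow D hD pol 3 Γ₁ hΓ₁₁ hΓ₁₂ hL' e a

end AbelianSchemeOver

end Literature.AlgebraicGeometry.AbelianSchemes

end
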